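import Literature.Barriers.QuantumFields.FreeTwoPointContinuation
import Literature.Barriers.QuantumFields.HaagTheoremContinuationProofs
import Mathlib.Analysis.Calculus.ParametricIntegral
import HarnessLib

/-!
# The free two-point function is holomorphic on the forward tube

Sibling proof file of `FreeTwoPointContinuation.lean` (theorems only). It proves that
`freeTwoPointHol d m ζ = ∫ (4πE)⁻¹ exp (2πi (E ζ⁰ + ξ⃗·ζ⃗)) dξ⃗` is complex differentiable on the tube
`{ζ | Im ζ ∈ V₊}` (`differentiableOn_freeTwoPointHol`), hence `freeTwoPointWightmanHol d m` is
complex differentiable on `{z | Im (z₁ − z₀) ∈ V₊} ⊇ forwardTube d 2`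
(`differentiableOn_freeTwoPointWightmanHol_forwardTube`): differentiation under the integral sign
(`hasFDerivAt_integral_of_dominated_of_fderiv_le`), the `ζ`-derivative of the integrand being the
integrand times the linear form `2πi (E dζ⁰ + ξ⃗·dζ⃗)`, dominated on a neighbourhood where
`Im ζ⁰ − ‖Im ζ⃗‖ > δ₀/2` by `K (1 + ‖ξ⃗‖) e^{−πδ₀‖ξ⃗‖}` (`norm_freeTwoPointHolIntegrand_le`,
`integrable_one_add_norm_pow_mul_exp_neg`). This is the free-field instance of Streater–Wightman
Thm 3-5 ("the Laplace transform … is a holomorphic function, by Theorem 2-8").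

## References

* R. F. Streater, A. S. Wightman, *PCT, Spin and Statistics, and All That*, §3-3 Thm 3-5 and its
  proof via Thm 2-8 (pdf pp. 100–101). [StreaterWightman2001]
-/

noncomputable section

open MeasureTheory Complex Real Filter Topology
open scoped InnerProductSpace

namespace Literature.Barriers.QuantumFields

open Literature.MathematicalPhysics.QuantumLattice

variable {d : ℕ}

/-! ### The linear form `E dζ⁰ + ξ⃗·dζ⃗` and the derivative of the integrand -/

/-- The `ℂ`-linear form `ζ ↦ E_m(ξ⃗) ζ⁰ + ξ⃗·ζ⃗` on `ℂ^{1+d}`. [folklore] -/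
theorem exists_clm_shell (m : ℝ) (ξ : EuclideanSpace ℝ (Fin d)) :
    ∃ L : (Fin (d + 1) → ℂ) →L[ℂ] ℂ,
      (∀ ζ, L ζ = (shellEnergy d m ξ : ℂ) * ζ 0 + spatialPairC d ξ ζ) ∧
      ‖L‖ ≤ shellEnergy d m ξ + ∑ i : Fin d, |ξ i| := by
  set L : (Fin (d + 1) → ℂ) →L[ℂ] ℂ :=
    (shellEnergy d m ξ : ℂ) • ContinuousLinearMap.proj (R := ℂ) (φ := fun _ : Fin (d + 1) => ℂ) 0 +
      ∑ i : Fin d, (ξ i : ℂ) • ContinuousLinearMap.proj (R := ℂ) (φ := fun _ : Fin (d + 1) => ℂ) i.succ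
    with hL
  have hLapply : ∀ ζ, L ζ = (shellEnergy d m ξ : ℂ) * ζ 0 + spatialPairC d ξ ζ := by
    intro ζ
    simp only [hL, add_apply, smul_apply, FunLike.coe_sum, Finset.sum_apply,
      ContinuousLinearMap.proj_apply, smul_eq_mul, spatialPairC]
  refine ⟨L, hLapply, ?_⟩
  have hE : 0 ≤ shellEnergy d m ξ := Real.sqrt_nonneg _
  refine ContinuousLinearMap.opNorm_le_bound _ (by positivity) fun ζ => ?_
  rw [hLapply]
  calc ‖(shellEnergy d m ξ : ℂ) * ζ 0 + spatialPairC d ξ ζ‖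
      ≤ ‖(shellEnergy d m ξ : ℂ) * ζ 0‖ + ‖spatialPairC d ξ ζ‖ := norm_add_le _ _
    _ ≤ shellEnergy d m ξ * ‖ζ‖ + (∑ i : Fin d, |ξ i|) * ‖ζ‖ := by
        gcongr
        · rw [norm_mul, Complex.norm_real, Real.norm_of_nonneg hE]
          exact mul_le_mul_of_nonneg_left (norm_le_pi_norm ζ 0) hE
        · rw [spatialPairC, Finset.sum_mul]
          refine (norm_sum_le _ _).trans (Finset.sum_le_sum fun i _ => ?_)
          rw [norm_mul, Complex.norm_real, Real.norm_eq_abs]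
          exact mul_le_mul_of_nonneg_left (norm_le_pi_norm ζ i.succ) (abs_nonneg _)
    _ = (shellEnergy d m ξ + ∑ i : Fin d, |ξ i|) * ‖ζ‖ := by ring

/-- The bound `E_m(ξ⃗) + Σ|ξᵢ| ≤ (d + 1 + |m|/2π)(1 + ‖ξ⃗‖)`. [folklore] -/
theorem shellEnergy_add_sum_abs_le (m : ℝ) (ξ : EuclideanSpace ℝ (Fin d)) :
    shellEnergy d m ξ + ∑ i : Fin d, |ξ i| ≤ ((d : ℝ) + 1 + |m| / (2 * π)) * (1 + ‖ξ‖) := by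
  have hE : shellEnergy d m ξ ≤ ‖ξ‖ + |m| / (2 * π) := by
    unfold shellEnergy
    rw [Real.sqrt_le_left (by positivity)]
    have : (m / (2 * π)) ^ 2 = (|m| / (2 * π)) ^ 2 := by
      rw [div_pow, div_pow, sq_abs]
    rw [this]
    nlinarith [norm_nonneg ξ, (by positivity : 0 ≤ |m| / (2 * π))]
  have hsum : ∑ i : Fin d, |ξ i| ≤ d * ‖ξ‖ := by
    calc ∑ i : Fin d, |ξ i| ≤ ∑ _i : Fin d, ‖ξ‖ := Finset.sum_le_sum fun i _ => abs_apply_le_norm ξ i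
      _ = d * ‖ξ‖ := by simp
  have hm : 0 ≤ |m| / (2 * π) := by positivity
  nlinarith [norm_nonneg ξ]

/-! ### Holomorphy by differentiation under the integral sign -/

/-- **The free holomorphic two-point function is complex differentiable on the tube**
`{ζ | Im ζ ∈ V₊}` (`m ≠ 0`): the Laplace transform of the positive-energy mass-shell measure,
Streater–Wightman Thm 3-5 / Thm 2-8 for the free field.
[cite: StreaterWightman2001, §3-3 Thm 3-5] -/
theorem differentiableOn_freeTwoPointHol {m : ℝ} (hm : m ≠ 0) :
    DifferentiableOn ℂ (freeTwoPointHol d m) {ζ | imPart ζ ∈ forwardCone d} := by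
  intro ζ₀ hζ₀
  -- the margin `δ(ζ) = Im ζ⁰ − ‖Im ζ⃗‖` and the neighbourhood where `δ > δ₀/2`
  set δ : (Fin (d + 1) → ℂ) → ℝ := fun ζ => (ζ 0).im - ‖spaceC d (imPart ζ)‖ with hδ
  have hδc : Continuous δ :=
    (Complex.continuous_im.comp (continuous_apply 0)).sub ((spaceC d).continuous.comp
      continuous_imPart).norm
  have hδ₀ : 0 < δ ζ₀ := by
    have h := (mem_forwardCone_iff_norm_lt (imPart ζ₀)).1 hζ₀
    rw [imPart_apply] at h
    simp only [hδ]
    linarith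
  set s : Set (Fin (d + 1) → ℂ) := {ζ | δ ζ₀ / 2 < δ ζ} with hs
  have hs_open : IsOpen s := isOpen_lt continuous_const hδc
  have hζ₀s : ζ₀ ∈ s := by show δ ζ₀ / 2 < δ ζ₀; linarith
  have hs_nhds : s ∈ 𝓝 ζ₀ := hs_open.mem_nhds hζ₀s
  have him0 : ∀ ζ ∈ s, 0 ≤ (ζ 0).im := by
    intro ζ hζ
    have h1 : δ ζ₀ / 2 < δ ζ := hζ
    have h2 : δ ζ ≤ (ζ 0).im := by
      show (ζ 0).im - ‖spaceC d (imPart ζ)‖ ≤ (ζ 0).im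
      linarith [norm_nonneg (spaceC d (imPart ζ))]
    linarith
  -- the linear forms and the derivative
  choose L hL hLnorm using fun ξ : EuclideanSpace ℝ (Fin d) => exists_clm_shell (d := d) m ξ
  set F : (Fin (d + 1) → ℂ) → EuclideanSpace ℝ (Fin d) → ℂ :=
    fun ζ ξ => freeTwoPointHolIntegrand d m ζ ξ with hF
  set F' : (Fin (d + 1) → ℂ) → EuclideanSpace ℝ (Fin d) → (Fin (d + 1) → ℂ) →L[ℂ] ℂ :=
    fun ζ ξ => (freeTwoPointHolIntegrand d m ζ ξ * (2 * π * I)) • L ξ with hF'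
  -- pointwise derivative of the integrand
  have hderiv : ∀ (ξ : EuclideanSpace ℝ (Fin d)) (ζ : Fin (d + 1) → ℂ),
      HasFDerivAt (fun ζ => F ζ ξ) (F' ζ ξ) ζ := by
    intro ξ ζ
    have h1 : HasFDerivAt (fun ζ : Fin (d + 1) → ℂ => (2 * π * I) • L ξ ζ)
        ((2 * π * I) • L ξ) ζ := (L ξ).hasFDerivAt.const_smul (2 * π * I)
    have h2 := h1.cexp
    have h3 := h2.const_smul (((4 * π * shellEnergy d m ξ)⁻¹ : ℝ) : ℂ)
    have hfeq : (fun ζ' : Fin (d + 1) → ℂ => F ζ' ξ) =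
        (((4 * π * shellEnergy d m ξ)⁻¹ : ℝ) : ℂ) •
          fun x : Fin (d + 1) → ℂ => cexp ((2 * π * I) • L ξ x) := by
      funext ζ'
      simp only [Pi.smul_apply, hF, freeTwoPointHolIntegrand, hL, smul_eq_mul, Complex.real_smul]
    have hdeq : F' ζ ξ = (((4 * π * shellEnergy d m ξ)⁻¹ : ℝ) : ℂ) •
        (cexp ((2 * π * I) • L ξ ζ) • ((2 * π * I) • L ξ)) := by
      ext v
      simp only [hF', freeTwoPointHolIntegrand, hL, smul_apply, smul_eq_mul, Complex.real_smul]
      ring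
    rw [hfeq, hdeq]
    exact h3
  -- the dominating function
  set K : ℝ := (4 * π * (|m| / (2 * π)))⁻¹ * (2 * π) * ((d : ℝ) + 1 + |m| / (2 * π)) with hK
  set bound : EuclideanSpace ℝ (Fin d) → ℝ :=
    fun ξ => K * ((1 + ‖ξ‖) ^ 1 * rexp (-(2 * π * (δ ζ₀ / 2) * ‖ξ‖))) with hbound
  have hbound_int : Integrable bound :=
    (integrable_one_add_norm_pow_mul_exp_neg (d := d) (β := 2 * π * (δ ζ₀ / 2)) (by positivity)
      1).const_mul K
  have hF'_le : ∀ (ξ : EuclideanSpace ℝ (Fin d)), ∀ ζ ∈ s, ‖F' ζ ξ‖ ≤ bound ξ := by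
    intro ξ ζ hζ
    have hδζ : δ ζ₀ / 2 < δ ζ := hζ
    have hm' : 0 < |m| / (2 * π) := by positivity
    calc ‖F' ζ ξ‖ ≤ ‖freeTwoPointHolIntegrand d m ζ ξ * (2 * π * I)‖ * ‖L ξ‖ :=
          ContinuousLinearMap.opNorm_smul_le _ _
      _ = ‖freeTwoPointHolIntegrand d m ζ ξ‖ * (2 * π) * ‖L ξ‖ := by
          rw [norm_mul]
          congr 2
          rw [norm_mul, Complex.norm_I, mul_one, Complex.norm_mul, Complex.norm_ofNat,
            Complex.norm_real, Real.norm_of_nonneg Real.pi_pos.le]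
      _ ≤ ((4 * π * (|m| / (2 * π)))⁻¹ * rexp (-2 * π * (δ ζ * ‖ξ‖))) * (2 * π) *
            (((d : ℝ) + 1 + |m| / (2 * π)) * (1 + ‖ξ‖)) := by
          gcongr
          · exact norm_freeTwoPointHolIntegrand_le hm (him0 ζ hζ) ξ
          · exact (hLnorm ξ).trans (shellEnergy_add_sum_abs_le m ξ)
      _ ≤ ((4 * π * (|m| / (2 * π)))⁻¹ * rexp (-(2 * π * (δ ζ₀ / 2) * ‖ξ‖))) * (2 * π) *
            (((d : ℝ) + 1 + |m| / (2 * π)) * (1 + ‖ξ‖)) := by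
          have hmono : (δ ζ₀ / 2) * ‖ξ‖ ≤ δ ζ * ‖ξ‖ :=
            mul_le_mul_of_nonneg_right hδζ.le (norm_nonneg ξ)
          have hexp : rexp (-2 * π * (δ ζ * ‖ξ‖)) ≤ rexp (-(2 * π * (δ ζ₀ / 2) * ‖ξ‖)) :=
            Real.exp_le_exp.2 (by nlinarith [Real.pi_pos])
          gcongr
      _ = bound ξ := by simp only [hbound, hK, pow_one]; ring
  -- measurability
  have hF_meas : ∀ᶠ ζ in 𝓝 ζ₀, AEStronglyMeasurable (F ζ) volume :=
    Eventually.of_forall fun ζ => (continuous_freeTwoPointHolIntegrand hm ζ).aestronglyMeasurable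
  have hF'_meas : AEStronglyMeasurable (F' ζ₀) volume := by
    have hLc : Continuous fun ξ : EuclideanSpace ℝ (Fin d) => L ξ := by
      have hLeq : (fun ξ : EuclideanSpace ℝ (Fin d) => L ξ) = fun ξ =>
          (shellEnergy d m ξ : ℂ) •
            ContinuousLinearMap.proj (R := ℂ) (φ := fun _ : Fin (d + 1) => ℂ) 0 +
          ∑ i : Fin d, (ξ i : ℂ) •
            ContinuousLinearMap.proj (R := ℂ) (φ := fun _ : Fin (d + 1) => ℂ) i.succ := by
        funext ξ
        ext ζ
        simp only [hL, add_apply, smul_apply, FunLike.coe_sum, Finset.sum_apply,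
          ContinuousLinearMap.proj_apply, smul_eq_mul, spatialPairC]
      rw [hLeq]
      refine ((Complex.continuous_ofReal.comp (continuous_shellEnergy m)).smul
        continuous_const).add (continuous_finsetSum _ fun i _ => ?_)
      exact (Complex.continuous_ofReal.comp (EuclideanSpace.proj i).continuous).smul
        continuous_const
    exact (((continuous_freeTwoPointHolIntegrand hm ζ₀).mul continuous_const).smul
      hLc).aestronglyMeasurable
  have key := hasFDerivAt_integral_of_dominated_of_fderiv_le (𝕜 := ℂ) (μ := volume)
    (F := F) (F' := F') (x₀ := ζ₀) (bound := bound) hs_nhds hF_meas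
    (integrable_freeTwoPointHolIntegrand hm hζ₀) hF'_meas
    (ae_of_all _ fun ξ ζ hζ => hF'_le ξ ζ hζ) hbound_int
    (ae_of_all _ fun ξ ζ _ => hderiv ξ ζ)
  exact key.differentiableAt.differentiableWithinAt

/-- The tube `{z | Im (z₁ − z₀) ∈ V₊}` of two-point configurations contains the forward tube
`forwardTube d 2`. [folklore] -/
theorem forwardTube_two_subset :
    forwardTube d 2 ⊆ {z : Fin 2 → Fin (d + 1) → ℂ | imPart (z 1 - z 0) ∈ forwardCone d} := by
  intro z hz
  have h := hz 1
  rw [show (1 : Fin 2) = (0 : Fin 1).succ from rfl, succDiff_succ] at h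
  exact h

/-- **The free holomorphic two-point function of two points is complex differentiable on
`{z | Im (z₁ − z₀) ∈ V₊}`** (`m ≠ 0`). [cite: StreaterWightman2001, §3-3 Thm 3-5] -/
theorem differentiableOn_freeTwoPointWightmanHol {m : ℝ} (hm : m ≠ 0) :
    DifferentiableOn ℂ (freeTwoPointWightmanHol d m)
      {z : Fin 2 → Fin (d + 1) → ℂ | imPart (z 1 - z 0) ∈ forwardCone d} := by
  have hlin : Differentiable ℂ fun z : Fin 2 → Fin (d + 1) → ℂ => z 1 - z 0 :=
    (differentiable_apply 1).sub (differentiable_apply 0)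
  intro z hz
  have h := (differentiableOn_freeTwoPointHol (d := d) hm) (z 1 - z 0) hz
  exact (h.differentiableAt ((isOpen_forwardCone.preimage continuous_imPart).mem_nhds hz)).comp_differentiableWithinAt
    z (hlin z).differentiableWithinAt

/-- **… in particular on the forward tube `forwardTube d 2`.**
[cite: StreaterWightman2001, §3-3 Thm 3-5] -/
theorem differentiableOn_freeTwoPointWightmanHol_forwardTube {m : ℝ} (hm : m ≠ 0) :
    DifferentiableOn ℂ (freeTwoPointWightmanHol d m) (forwardTube d 2) :=
  (differentiableOn_freeTwoPointWightmanHol hm).mono forwardTube_two_subset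

end Literature.Barriers.QuantumFields
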